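import Summits.KontsevichZagierPeriods.KontsevichZagierPeriods.Theorems.LinRedNormalFormArrangementNormalFormSeparateTwoZeroWeights
import Summits.KontsevichZagierPeriods.KontsevichZagierPeriods.Theorems.LinRedNormalFormArrangementNormalFormSeparateTwoZeroCone
import Summits.KontsevichZagierPeriods.KontsevichZagierPeriods.Theorems.LinRedNormalFormArrangementNormalFormSeparateTwoZeroAux

/-!
# The lower power bound: absolute convergence forces the exponent inequality

(Line `janus-bands`, crux `ArrangementNormalForm`, stub `stub_separateTwoZero` — separation in a
good rational direction for PLANAR arrangement representations without fibres; part `Lower`.)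

`exponent_lt` (registered as `separateTwoZero_lower`): if `F = p(u,λ)/(u^E W₁(u)) · λ^{-n}`,
with `p` a double sum of order `D` at the origin, is absolutely integrable on a polygon adherent to
the origin, then `n + E < D + 2`: a good sector at the origin inside the polygon missing the root
directions of the lowest homogeneous part of `p` (`exists_sector_subset`, `exists_Icc_poly_ne_zero`,
`SepTwo.lower_bound_on_good_directions`), on which `|F| ≥ c |u|^D/|u|^{n+E}`, and the divergence
`lt_of_integrableOn_sector`.
-/

noncomputable section

open Set MeasureTheory Filter Topology
open scoped ENNReal

namespace Summit.KontsevichZagierPeriods.ArrangementNormalForm.JanusBands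

namespace SepTwoZero

section Lower

variable {J : ℕ} (g : Fin J → ℝ × ℝ × ℝ)

/-- **Lower power bound ⟹ exponent inequality.** If the integrand
`F = p(u,λ)/(u^E W₁(u)) · λ^{-n}` (with `p` a double sum of order `D` at the origin) is
absolutely integrable on a polygon adherent to the origin, then `n + E < D + 2`. -/
theorem exponent_lt {D n E : ℕ} (T : Finset (ℕ × ℕ)) (c : ℕ × ℕ → ℝ)
    (hd : ∀ im ∈ T, c im ≠ 0 → D ≤ im.1 + im.2)
    (him₀ : ∃ im₀ ∈ T, c im₀ ≠ 0 ∧ im₀.1 + im₀.2 = D)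
    (W₁ : ℝ → ℝ) (hW0 : W₁ 0 ≠ 0) {ρW CW : ℝ} (hρW : 0 < ρW)
    (hCW : 0 < CW) (hWb : ∀ u : ℝ, |u| < ρW → |W₁ 0| / 2 ≤ |W₁ u| ∧ |W₁ u| ≤ CW)
    (h0 : ∀ j, 0 ≤ aff (g j) 0) (hne : (Om g).Nonempty)
    (F : ℝ × ℝ → ℝ) (hF : IntegrableOn F (Om g))
    (hFeq : EqOn F (fun w => SepTwo.dsum T c w.1 w.2 / (w.1 ^ E * W₁ w.1) * (1 / w.2) ^ n) (Om g))
    (hpole : n ≠ 0 → ∀ w ∈ Om g, w.2 ≠ 0) : n + E < D + 2 := by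
  classical
  obtain ⟨σ, m₁, m₂, δ, hσ, hm, hδ, hsec⟩ := exists_sector_subset g h0 hne hρW
  have hσa : |σ| = 1 := by rcases hσ with rfl | rfl <;> simp
  have hσ2 : σ * σ = 1 := by rcases hσ with rfl | rfl <;> norm_num
  -- the direction polynomial and a good closed slope interval
  set e : ℕ → ℝ := fun k => if (k, D - k) ∈ T then c (k, D - k) else 0 with he
  have hek : ∃ k < D + 1, e k ≠ 0 := by
    obtain ⟨im₀, hT, hc, hdeg⟩ := him₀
    refine ⟨im₀.1, by omega, ?_⟩
    have : (im₀.1, D - im₀.1) = im₀ := Prod.ext rfl (by simp; omega)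
    simp only [he, this, if_pos hT]; exact hc
  obtain ⟨a, b, ha, hab, hb, hpoly⟩ := exists_Icc_poly_ne_zero e (D + 1) hek hm
  set K₀ := |a| + |b| + 1 with hK₀
  have hK₀1 : 1 ≤ K₀ := by rw [hK₀]; linarith [abs_nonneg a, abs_nonneg b]
  have hK₀0 : 0 < K₀ := by linarith
  have hmK : ∀ m ∈ Icc a b, |m| ≤ K₀ - 1 := fun m hm' => by
    rw [hK₀]; have := abs_le_max_abs_abs hm'.1 hm'.2
    linarith [le_max_left |a| |b|, le_max_right |a| |b|, max_le_add_of_nonneg (abs_nonneg a)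
      (abs_nonneg b)]
  set Dset := (fun m : ℝ => (σ / K₀, σ * m / K₀)) '' Icc a b with hDset
  have hcpt : IsCompact Dset := isCompact_Icc.image (by fun_prop)
  have hD1 : ∀ w ∈ Dset, |w.1| + |w.2| ≤ 1 := by
    rintro w ⟨m, hm', rfl⟩
    simp only [abs_div, abs_mul, hσa, abs_of_pos hK₀0, one_mul]
    rw [← add_div, div_le_one hK₀0]
    linarith [hmK m hm']
  have hne' : ∀ w ∈ Dset, SepTwo.dpart T c D w.1 w.2 ≠ 0 := by
    rintro w ⟨m, hm', rfl⟩
    have h1 : SepTwo.dpart T c D (σ / K₀) (σ * m / K₀) = (σ / K₀) ^ D * SepTwo.dpart T c D 1 m := by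
      rw [← dpart_smul]; congr 1 <;> ring
    simp only [h1]
    refine mul_ne_zero (pow_ne_zero _ (div_ne_zero (by rw [← abs_ne_zero, hσa]; norm_num)
      hK₀0.ne')) ?_
    rw [dpart_one_eq]; exact hpoly m hm'
  obtain ⟨c₀, hc₀, r₀, hr₀, hlow⟩ :=
    SepTwo.lower_bound_on_good_directions T c D hd Dset hcpt hD1 hne'
  -- the sector
  set δ' := min δ (r₀ / K₀) with hδ'
  have hδ'pos : 0 < δ' := lt_min hδ (div_pos hr₀ hK₀0)
  set S := {w : ℝ × ℝ | σ * w.1 ∈ Ioo 0 δ' ∧ w.2 / w.1 ∈ Ioo a b} with hS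
  have hSsub : ∀ w ∈ S, w ∈ Om g ∧ |w.1| < ρW ∧ |w.2| < ρW := fun w hw =>
    hsec w ⟨hw.1.1, hw.1.2.trans_le (min_le_left _ _)⟩ ⟨ha.trans hw.2.1, hw.2.2.trans hb⟩
  set κ := c₀ / (CW * K₀ ^ n) with hκ
  have hκ0 : 0 < κ := by positivity
  -- the key lower bound on the sector
  have key : ∀ w ∈ S, κ * (|w.1| ^ D / |w.1| ^ (n + E)) ≤ |F w| := by
    intro w hw
    obtain ⟨hwO, hw1, hw2⟩ := hSsub w hw
    set s := σ * w.1 with hs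
    have hs0 : 0 < s := hw.1.1
    have hws : w.1 = σ * s := by rw [hs, ← mul_assoc, hσ2, one_mul]
    have hw10 : w.1 ≠ 0 := by rw [hws]; exact mul_ne_zero (by rw [← abs_ne_zero, hσa]; norm_num) hs0.ne'
    have habs1 : |w.1| = s := by rw [hws, abs_mul, hσa, one_mul, abs_of_pos hs0]
    set m := w.2 / w.1 with hmdef
    have hm' : m ∈ Icc a b := ⟨hw.2.1.le, hw.2.2.le⟩
    have hwm : w.2 = m * w.1 := by rw [hmdef]; field_simp
    have habs2 : |w.2| ≤ K₀ * s := by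
      rw [hwm, abs_mul, habs1]
      exact mul_le_mul_of_nonneg_right (by linarith [hmK m hm']) hs0.le
    -- the double sum along the ray
    have hdir : (σ / K₀, σ * m / K₀) ∈ Dset := ⟨m, hm', rfl⟩
    have ht : s * K₀ ∈ Icc (0 : ℝ) r₀ := by
      refine ⟨by positivity, ?_⟩
      have : s < r₀ / K₀ := hw.1.2.trans_le (min_le_right _ _)
      rw [lt_div_iff₀ hK₀0] at this; exact this.le
    have hds := hlow _ hdir (s * K₀) ht
    have harg1 : s * K₀ * (σ / K₀) = w.1 := by rw [hws]; field_simp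
    have harg2 : s * K₀ * (σ * m / K₀) = w.2 := by rw [hwm, hws]; field_simp
    simp only [harg1, harg2] at hds
    have hds' : c₀ * s ^ D ≤ |SepTwo.dsum T c w.1 w.2| := by
      refine le_trans ?_ hds
      gcongr
      exact le_mul_of_one_le_right hs0.le hK₀1
    -- the denominators
    obtain ⟨hWl, hWu⟩ := hWb w.1 hw1
    have hWpos : 0 < |W₁ w.1| := by linarith [abs_pos.2 hW0]
    have hln : 0 < |w.2| ^ n := by
      rcases Nat.eq_zero_or_pos n with hn | hn
      · simp [hn]
      · exact pow_pos (abs_pos.2 (hpole hn.ne' w hwO)) _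
    have h2 : 1 / (s ^ E * CW) ≤ 1 / (|w.1| ^ E * |W₁ w.1|) := by
      rw [habs1]; gcongr
    have h3 : 1 / (K₀ ^ n * s ^ n) ≤ 1 / |w.2| ^ n := by
      rw [← mul_pow]; exact one_div_le_one_div_of_le hln (pow_le_pow_left₀ (abs_nonneg _) habs2 _)
    have hF : |F w| = |SepTwo.dsum T c w.1 w.2| * (1 / (|w.1| ^ E * |W₁ w.1|)) * (1 / |w.2| ^ n) := by
      rw [hFeq hwO]; simp only [abs_mul, abs_div, abs_pow, abs_one]; ring
    rw [hF]
    calc κ * (|w.1| ^ D / |w.1| ^ (n + E)) = (c₀ * s ^ D) * (1 / (s ^ E * CW)) * (1 / (K₀ ^ n * s ^ n)) := by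
          rw [habs1, hκ, pow_add]; field_simp
      _ ≤ _ := by gcongr
  -- integrability of the weight on the sector, and the conclusion
  have hSO : S ⊆ Om g := fun w hw => (hSsub w hw).1
  have hint : IntegrableOn (fun w : ℝ × ℝ => |w.1| ^ D / |w.1| ^ (n + E)) S := by
    refine Integrable.mono' ((hF.mono_set hSO).norm.const_mul κ⁻¹) ?_ ?_
    · exact (Measurable.aestronglyMeasurable (by fun_prop))
    · have hSm : MeasurableSet S := by
        rw [hS]
        refine (measurableSet_Ioo.preimage (measurable_const_mul σ |>.comp measurable_fst)).inter ?_
        exact measurableSet_Ioo.preimage (measurable_snd.div measurable_fst)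
      refine (ae_restrict_iff' hSm).2 (Eventually.of_forall fun w hw => ?_)
      rw [Real.norm_eq_abs, abs_of_nonneg (by positivity), Real.norm_eq_abs,
        ← div_eq_inv_mul, le_div_iff₀ hκ0, mul_comm]
      exact key w hw
  exact lt_of_integrableOn_sector hδ'pos hab hσ hint

end Lower

end SepTwoZero

open SepTwoZero in
/-- **The exponent inequality** (registered sub-goal of `stub_separateTwoZero`; see `SepTwoZero.exponent_lt`). -/
theorem separateTwoZero_lower {J : ℕ} (g : Fin J → ℝ × ℝ × ℝ) {D n E : ℕ} (T : Finset (ℕ × ℕ)) (c : ℕ × ℕ → ℝ) (hd : ∀ im ∈ T, c im ≠ 0 → D ≤ im.1 + im.2) (him₀ : ∃ im₀ ∈ T, c im₀ ≠ 0 ∧ im₀.1 + im₀.2 = D) (W₁ : ℝ → ℝ) (hW0 : W₁ 0 ≠ 0) {ρW CW : ℝ} (hρW : 0 < ρW) (hCW : 0 < CW) (hWb : ∀ u : ℝ, |u| < ρW → |W₁ 0| / 2 ≤ |W₁ u| ∧ |W₁ u| ≤ CW) (h0 : ∀ j, 0 ≤ SepTwoZero.aff (g j) 0) (hne : (SepTwoZero.Om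 g).Nonempty) (F : ℝ × ℝ → ℝ) (hF : IntegrableOn F (SepTwoZero.Om g)) (hFeq : EqOn F (fun w => SepTwo.dsum T c w.1 w.2 / (w.1 ^ E * W₁ w.1) * (1 / w.2) ^ n) (SepTwoZero.Om g)) (hpole : n ≠ 0 → ∀ w ∈ SepTwoZero.Om g, w.2 ≠ 0) : n + E < D + 2 := by
  exact exponent_lt g T c hd him₀ W₁ hW0 hρW hCW hWb h0 hne F hF hFeq hpole

end Summit.KontsevichZagierPeriods.ArrangementNormalForm.JanusBands
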